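import Summits.QuantumFields.YangMills.Theorems.BalabanUVNodesK0AxComplexGaussianRatioTail
import Summits.QuantumFields.YangMills.Theorems.BalabanUVNodesK0AxCauchyDecoupling
import Summits.Ventures.HodgeRepro2.T5ParametricHolomorphy

/-!
# K0ᴬ∕K0⁷ — CGRS file №3: HOLOMORPHY OF DOMINATED PARAMETRIC INTEGRALS BY CAUCHY ESTIMATES (generic) and the holomorphy half (H-den)(H-num)(H-rat) of N4-R for DEF-1's
# complex-parameter Gaussian carriers `gaussNormC`, `gaussIntC`, `gaussRatioC` (◇ lens-1 g13 NODE v14 §1 «N4-R-hol ⟸ (H-num)(H-den) ∘ (F-coer-unif)(F-Mhol)»; model-free, Mathlib-only)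

LANDING NOTE (porter ▶ PTC-1 g4, 2026-08-31; AUTHORSHIP = ◇ lens-1 g13 «cauchy-analytic», HOME file `nodeO-cover/LENS-1g13-ComplexGaussianRatioHolo-v3.lean` sha16 18cb11dac78ca28b · 337 l. · 18
thm · 0 def (CANDIDATE 4 (b) = CGRS FILE №3: the holomorphy half (H-den)∕(H-num)∕(H-rat) of N4-R for DEF-1's complex-parameter Gaussian carriers — §12 the coercive regime
(`posDef_map_re_gaussSymmPart_of_coercive`, `gaussNormC_ne_zero_of_coercive`, `norm_gaussRatioC_le_exp_trace_of_coercive`), `differentiableOn_gaussNormC∕gaussIntC∕gaussRatioC`,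
`hasDerivAt_gaussNormC`; §13 docking onto ✓`…K0AxCauchyDecoupling` in SEPARATE form: `sepHolOff_gaussRatioC`, `bddOnPoly_gaussRatioC`); farm evidence = ◇'s monolith
`nodeO-cover/evidence/LENS-1g13-CGR-TailHoloRecord-monolith-check-v2.lean` d4bc800c1c2dd911 rc 0 · 0 warn · 0 sorry, finals' axioms standard). EDITION LANDED = v4 := v3 ⊕ ◆ CRIT-1 g39's rider R-m
(J4 «reuse, do not re-declare», nodeO STATUS 2026-08-31T15:39:29Z), a MECHANICAL edit by this seat's generator `ymgap-nodeO-port-PTC-1/split-CGR/build_holo_v4.py` (edition bytes published there as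
`src-LENS-1g13-ComplexGaussianRatioHolo-v4-Rm.lean`, farm rc 0 · 0 warn · 0 sorry, axioms standard): the three generic §11 theorems of v3 (`aestronglyMeasurable_deriv_of_differentiableOn`,
`hasDerivAt_integral_of_dominated_of_differentiableOn`, `differentiableOn_integral_of_dominated_of_differentiableOn`; −80 l.) are STATEMENT TWINS (ℂ-valued specialisations) of
✓`Summits/Ventures/HodgeRepro2/T5ParametricHolomorphy.lean` :37∕:80∕:114 and are therefore NOT re-declared — that module is IMPORTED instead of `Mathlib.Analysis.Calculus.ParametricIntegral`
(cross-summit imports are legal in this tree; precedents `Summits/QuantumFields/GaugeBoot/DiagonalRPTorusCharacterMoments.lean` :1, `…/YangMills/Theorems/WeakCouplingRatesCalibrationTransfer.lean`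
:2), its two theorems opened by name, the three call sites re-pointed (`…_of_dominated_of_differentiableOn hU` ↦ `…_of_dominated_on hU`, `(g := …)` ↦ `(bound := …)`), the now-unused `variable {α}
[MeasurableSpace α] {μ}` line dropped and ONE header sentence reworded; every other byte (§11's docking face `sepHolOff_of_differentiableOn`, all of §12–§13, all docstrings) VERBATIM; 15 thm
remain; plus this paragraph. Target = ◇'s basename `…Theorems/BalabanUVNodesK0AxComplexGaussianRatioHolo.lean` (ns `…Theorems.K0AxComplexGaussianRatio`), imports ✓p827233
`…K0AxComplexGaussianRatioTail` + ✓p824330 `…K0AxCauchyDecoupling` + ✓`Summits.Ventures.HodgeRepro2.T5ParametricHolomorphy`, as INTENT-83; `--supports stmt-QuantumFields-27930 --as helper --cite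
Balaban1987RG1 --cite Balaban1988RG2Cluster --cite Brydges1986` (NO `--workitem`; kind auto ⇒ proof). ◆ CRIT-1's cut: ◆ CRIT-1 g39 «(1) CUT + J-STAMP — ◇ CANDIDATE 4, file №3 18cb11dac78ca28b ·
337 l. · 18 thm · 0 def · 0 `: Prop :=`∕instance∕notation∕structure∕sorry → GO ⊕ R-m; kernel: probe `scratch/Crit1CutH4_HoloRecord_verbatim.lean` (№3 v3 ⊕ №4 v1 on the TREE imports + 25 std
guards) farm rc 0 · 0 err · 0 warn · 0 sorry, planted negative control rc 1 as expected; J1′: theorems only, every regime hypothesis displayed (`IsOpen U`, a.e.-holomorphy, ONE uniform dominator,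
coercivity `a > 0`, `|χ| ≤ 1`∕`0 ≤ χ ≤ 1`, `Re E ≤ η` on `supp χ` uniformly, trace budget `τ`), conclusions `SepHolOff R []`∕`BddOnPoly R (e^{η+τ∕4})`∕`DifferentiableOn` NOT among the hypotheses ⇒
not a tautology; (F-coer) over COMPLEX `s ∈ cpoly R'` = v17's KEPT number (E3″), satisfiable ⇒ NOT vacuous; `gaussNormC ≠ 0` from coercivity via №2's symmetrisation ✓; J5′∕(Q-ord): none; J4
STATEMENT-TWIN (located): §11's three generic theorems ARE ℂ-valued specialisations of ✓`Summits/Ventures/HodgeRepro2/T5ParametricHolomorphy.lean` :37∕:80∕:114 — importable (precedents ×3 of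
`Summits/QuantumFields/…` importing `Summits.Ventures.…`) ⇒ RIDER R-m (J4 «reuse, do not re-declare»; recipe verified: `scratch/CGRHolo_v4_recipe.lean` 649f0c558437af9d · 256 l. · 15 thm, probe
recipe ⊕ №4 ⊕ 22 std guards farm rc 0 · 0 err · 0 warn · 0 sorry ⇒ №4 and every §12–§13 consumer UNAFFECTED); SAME-WALL: S, generic Mathlib calculus; located-A = N4-R's holomorphy half
(H-den)(H-num)(H-rat) + BOTH docking inputs of ✓`norm_decDiffList_le_exp_of_le_length` manufactured from coercivity-only hypotheses (κ arbitrary); located-B UNCHANGED = the MODEL faces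
(F-coer)∕(F-int)∕(F-im), the (R-b) bridge `recordFluctRatioC` ↔ print (2.12)–(2.13), N8b ⇒ SURVIVES priced» (nodeO STATUS 2026-08-31T15:39:29Z; «R-m on №3 stands» 15:46:29Z) — AUTHOR'S CONSENT ◇
lens-1 g13 «(A) CONSENT: №3 := v4-Rm 2acb813e53eb1973 AS ▶ BUILT IT (R-m is the right J4 move; §12–§13 names∕statements unchanged ⇒ files №4∕№5∕№6 import-stable, 0 references to the three deleted
§11 names)» (2026-08-31T15:46:38Z). GATE NOTE at v3's dry-run (15:34Z, verdict ACCEPT): `dedup.foreign` — `integrable_exp_neg_mul_sum_sq_pi` prints like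
`Summit.CriticalPhenomena.CardyFormulaZ2.Theorems.GaussianDilation.integrable_exp_neg_mul_sumSq`
(`Summits/CriticalPhenomena/CardyFormulaZ2/Theorems/CardyFlipRussoQuadrupoleSelectionRuleGaussianDilation.lean`, another summit) — a 10-line Mathlib-level integrability face, cited as twin and
kept (a note, not a bounce; importing that 300-line percolation module for it is not worth the dependency). HONEST (porter): Mathlib complex analysis ∕ measure theory about DEF-1's vocabulary
(typed ≠ inhabited); N4-R's MODEL faces (F-coer)∕(F-int)∕(F-im) are DISPLAYED hypotheses inhabited NOWHERE; the bridge of `recordFluctRatioC` to print's (2.12)–(2.13) is ◆ (R-b) stage 2, not here;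
nothing of Bałaban asserted, ported, discharged or refuted; `stub_FE`∕`stub_P0C` and the crux ⟨27930⟩ OPEN; K0⁷ 20541 ∕ K0ᴬ 27238 ∕ K1ᴬ ∕ K3ᴬ OPEN — NOTHING of them proved; NODE O 0∕1; COUNT 8∕28
· K 1∕4 UNMOVED; finite 𝕋⁴ at fixed ε — NOT continuum ∕ OS ∕ Clay; the Yang–Mills mass gap is NOT proved by any of this.

WHAT.  §11 IMPORTS ✓`Summit.Ventures.HodgeRepro2.T5ParametricHolomorphy.hasDerivAt_integral_of_dominated_on` ∕ `differentiableOn_integral_of_dominated_on` — the classical theorem «`F(t,a)` holomorphic in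
`t ∈ U` (open) for a.e. `a`, measurable in `a`, and `‖F(t,a)‖ ≤ g(a)` with `g ∈ L¹` UNIFORMLY in `t ∈ U` ⟹ `t ↦ ∫F(t,a)dμ(a)` is holomorphic on `U` with derivative `∫∂_tF`»; the point is that
NO derivative bound is asked of the consumer: it is manufactured from the uniform dominator by the CAUCHY ESTIMATE `‖∂_tF(t,a)‖ ≤ g(a)∕δ` on balls `closedBall t δ ⊆ U`
(`Complex.norm_deriv_le_of_forall_mem_sphere_norm_le`), and the measurability of `a ↦ ∂_tF(t₀,a)` from difference quotients along `t₀ + δ∕(n+2)` (`aestronglyMeasurable_deriv_param` there);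
then Mathlib's `hasDerivAt_integral_of_dominated_loc_of_deriv_le`.  IN-TREE PRECEDENT (J4 stmt-dedup, said up front): the SAME generic theorem (general complete codomain `E`,
radius `ρ∕4`) is ✓`Summits/Ventures/HodgeRepro2/T5ParametricHolomorphy.lean` :80 `hasDerivAt_integral_of_dominated_on` ∕ :114 `differentiableOn_integral_of_dominated_on` in ANOTHER summit
— IMPORTED, not re-declared (◆ CRIT-1 g39 rider R-m, J4 «reuse»: cross-summit imports are legal in this tree, precedents `Summits/QuantumFields/GaugeBoot/DiagonalRPTorusCharacterMoments.lean` :1, `…/YangMills/Theorems/WeakCouplingRatesCalibrationTransfer.lean` :2), so §11 keeps only the docking face `sepHolOff_of_differentiableOn`; §12 is the new reach.  §12 applications to DEF-1's carriers (✓`…K0RecordFormatNamesFluctRatioC` :70∕:75∕:80), for a matrix family `M : ℂ → Matrix ι ι ℂ`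
with holomorphic entries on `U` and UNIFORM real-part coercivity `a·Σx_i² ≤ Re quadC (M t) x` (`a > 0`): ★★ `differentiableOn_gaussNormC` (H-den), ★★ `differentiableOn_gaussIntC` (H-num: `χ` measurable with
`|χ| ≤ 1`, `E t x` holomorphic in `t` and measurable in `x`, `Re E ≤ η` on `{χ ≠ 0}` uniformly), ★★★ `differentiableOn_gaussRatioC` (H-rat; the denominator's non-vanishing is
`gaussNormC_ne_zero_of_coercive` below, from the same coercivity), ★ `hasDerivAt_gaussNormC` (the derivative formula), and the docking face onto ✓`…K0AxCauchyDecoupling` :124 `SepHolOff`: `sepHolOff_of_differentiableOn`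
(one-variable holomorphy on a ball of radius `R' > R` through every coordinate line of the closed polydisc ⟹ `SepHolOff R [] G`), and §13 ★★ `sepHolOff_gaussRatioC` ∕ ★★ `bddOnPoly_gaussRatioC` — the TWO inputs of ✓`norm_decDiffList_le_exp_of_le_length` :207 for `G := s ↦ gaussRatioC χ (M s) (E s)` from SEPARATE
holomorphy of entries∕interaction along the coordinate lines through `cpoly R` (parameter index `κ` arbitrary, e.g. print's `(Fin 4 → ℤ)`), measurability, `|χ| ≤ 1`, uniform coercivity
`a > 0` and `Re E ≤ η` on `supp χ` over `cpoly R'` (`R < R'`), resp. over `cpoly R` (+ the imaginary-part trace budget `τ`): N4-R's generic half is thereby COMPLETE — what remains displayed is exactly the four MODEL faces (F-coer)(F-im)(F-int)(F-Mhol).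

HONEST FRAMING.  Mathlib theorems about parametric integrals; junk discipline ◆ (R-a): no `def … : Prop`, every regime hypothesis displayed (`IsOpen U`, measurability, a.e. holomorphy, the
uniform dominator, coercivity `a > 0`, `|χ| ≤ 1`, `Re E ≤ η` on `supp χ`, the trace budget `τ`).  The MODEL faces of N4-R — that `piecesFormC F k K T (w s) ψ` has holomorphic (indeed polynomial)
entries in each `s_y` and in `ψ`, that its real part is uniformly coercive with `a = γ₀∕2` on `cpoly(e^{κ₁}) × recordUc` ((E3)∕(P5ᶜ) currency), that the small-field interaction `E` obeys
`Re E ≤ η_□|c|` there — are NOT asserted here (hands' currency); nothing of [Balaban1987RG1]∕[Balaban1988RG2Cluster] is ported or discharged; `stub_FE`∕`stub_P0C` OPEN, ⟨27930⟩ OPEN;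
K0⁷∕K0ᴬ∕K1ᴬ∕K3ᴬ OPEN; NODE O 0∕1; finite `𝕋⁴_{L^K}` at fixed ε — NOT continuum∕OS; **the Yang–Mills mass gap (Clay) is NOT proved by any of this.**  No `sorry`, `instance`,
`notation`, `structure`, `private`; standard axioms.
-/

noncomputable section

open scoped BigOperators Topology
open MeasureTheory Complex Metric Set Filter Function

namespace Summit.QuantumFields.YangMills.Theorems.K0AxComplexGaussianRatio

open Summit.QuantumFields.YangMills.Theorems.K0RecordFormatNames (quadC gaussIntC gaussNormC gaussRatioC)
open Summit.QuantumFields.YangMills.Theorems.K0AxCauchyDecoupling (cpoly SepHolOff BddOnPoly update_mem_cpoly)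
open Summit.Ventures.HodgeRepro2.T5ParametricHolomorphy (hasDerivAt_integral_of_dominated_on differentiableOn_integral_of_dominated_on)

/-! ## §11  Holomorphy of dominated parametric integrals (generic; Cauchy estimates supply the derivative bound) -/

section HoloParam

/-- DOCKING FACE onto the Cauchy–decoupling brick: one-variable holomorphy along every coordinate line of the closed polydisc `cpoly R`, on a ball of radius `R' > R`, gives
`SepHolOff R [] G` (✓`…K0AxCauchyDecoupling` :124). [cite: Balaban1988RG2Cluster, (1.10) p.4–5 (locator)] -/
theorem sepHolOff_of_differentiableOn {κ : Type*} [DecidableEq κ] {R R' : ℝ} (hRR' : R < R') (G : (κ → ℂ) → ℂ)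
    (h : ∀ s ∈ cpoly (ι := κ) R, ∀ y : κ, DifferentiableOn ℂ (fun t : ℂ => G (update s y t)) (ball (0 : ℂ) R')) :
    SepHolOff R [] G := fun s hs y _ =>
  (h s hs y).diffContOnCl_ball (closedBall_subset_ball hRR')

end HoloParam

/-! ## §12  The holomorphy half of N4-R for DEF-1's carriers: (H-den) `gaussNormC`, (H-num) `gaussIntC`, (H-rat) `gaussRatioC` -/

section GaussHolo

open Matrix

variable {ι : Type*} [Fintype ι]

/-! ### Coercivity ⟹ the CGRS regime (no `PosDef`∕`IsSymm` letters on the consumer side) -/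

/-- Uniform real-part COERCIVITY of the quadratic form (`a·Σx_i² ≤ Re quadC M x`, `a > 0` — the shape (E3)∕(P5ᶜ) deliver) makes the real part of the SYMMETRIC PART positive-definite
(the antisymmetric part of `Re M` is invisible to the form). [cite: Balaban1987RG1, (2.19) p.270 (positivity of the real part; locator)] -/
theorem posDef_map_re_gaussSymmPart_of_coercive [DecidableEq ι] (M : Matrix ι ι ℂ) {a : ℝ} (ha : 0 < a)
    (h : ∀ x : ι → ℝ, a * ∑ i, x i ^ 2 ≤ (quadC M x).re) : ((gaussSymmPart M).map Complex.re).PosDef := by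
  refine Matrix.posDef_iff_dotProduct_mulVec.mpr ⟨?_, fun x hx => ?_⟩
  · have hs : ((gaussSymmPart M).map Complex.re).IsSymm := (isSymm_gaussSymmPart M).map _
    show _ᴴ = _
    rw [Matrix.conjTranspose_eq_transpose_of_trivial]
    exact hs
  · have hq : star x ⬝ᵥ (((gaussSymmPart M).map Complex.re) *ᵥ x) = (quadC M x).re := by
      rw [star_trivial, ← quadFormR_eq_dotProduct, ← re_quadC, quadC_gaussSymmPart]
    rw [hq]
    have hpos : 0 < ∑ i, x i ^ 2 := by
      obtain ⟨i, hi⟩ := Function.ne_iff.mp hx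
      exact lt_of_lt_of_le (lt_of_le_of_ne (sq_nonneg (x i)) (Ne.symm (pow_ne_zero 2 hi)))
        (Finset.single_le_sum (fun j _ => sq_nonneg (x j)) (Finset.mem_univ i))
    exact lt_of_lt_of_le (mul_pos ha hpos) (h x)

/-- ★★ Hence under uniform real-part coercivity the complex normalisation does NOT vanish — the form in which (H-rat) below consumes it. [cite: Balaban1987RG1, (2.12)+(2.19) p.268–270 (locator)] -/
theorem gaussNormC_ne_zero_of_coercive [DecidableEq ι] (M : Matrix ι ι ℂ) {a : ℝ} (ha : 0 < a)
    (h : ∀ x : ι → ℝ, a * ∑ i, x i ^ 2 ≤ (quadC M x).re) : gaussNormC M ≠ 0 :=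
  gaussNormC_ne_zero_gaussSymmPart M (posDef_map_re_gaussSymmPart_of_coercive M ha h)

/-- ★★ … and CGRS (iii) holds with the coercivity constant ALONE displayed (no symmetry, no `PosDef` letter): `‖gaussRatioC χ M E‖ ≤ exp(η + ¼·tr(S⁻¹B S⁻¹B))` with `S := Re ½(M+Mᵀ)`,
`B := Im ½(M+Mᵀ)`. [cite: Balaban1987RG1, (2.12)–(2.13)+(2.19) p.268–270 (locator); Brydges1986, Part III §2 (locator)] -/
theorem norm_gaussRatioC_le_exp_trace_of_coercive [DecidableEq ι] (χ : (ι → ℝ) → ℝ) (M : Matrix ι ι ℂ) (E : (ι → ℝ) → ℂ) (η : ℝ) {a : ℝ} (ha : 0 < a)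
    (h : ∀ x : ι → ℝ, a * ∑ i, x i ^ 2 ≤ (quadC M x).re)
    (hχ : ∀ x, 0 ≤ χ x ∧ χ x ≤ 1) (hE : ∀ x, χ x ≠ 0 → (E x).re ≤ η) :
    ‖gaussRatioC χ M E‖
      ≤ Real.exp (η + (1 / 4 : ℝ) * (((gaussSymmPart M).map Complex.re)⁻¹ * (gaussSymmPart M).map Complex.im
          * ((gaussSymmPart M).map Complex.re)⁻¹ * (gaussSymmPart M).map Complex.im).trace) :=
  norm_gaussRatioC_le_exp_trace_gaussSymmPart χ M E η (posDef_map_re_gaussSymmPart_of_coercive M ha h) hχ hE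

/-- `t ↦ quadC (M t) x` is holomorphic on `U` when the entries of `M` are. [cite: Balaban1988RG2Cluster, (1.9)–(1.10) p.4 (the s-dependence enters through the matrix; locator)] -/
theorem differentiableOn_quadC_param {U : Set ℂ} (M : ℂ → Matrix ι ι ℂ) (hM : ∀ i j, DifferentiableOn ℂ (fun t => M t i j) U) (x : ι → ℝ) :
    DifferentiableOn ℂ (fun t => quadC (M t) x) U := by
  unfold quadC
  refine DifferentiableOn.fun_sum fun i _ => DifferentiableOn.fun_sum fun j _ => ?_
  exact ((differentiableOn_const _).mul (hM i j)).mul (differentiableOn_const _)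

/-- Real part of `−½·q`. [cite: Balaban1987RG1, (2.12) p.268 (bookkeeping)] -/
theorem re_neg_half_mul (q : ℂ) : (-(1 / 2 : ℂ) * q).re = -(1 / 2 : ℝ) * q.re := by
  rw [show (-(1 / 2 : ℂ)) = ((-(1 / 2 : ℝ) : ℝ) : ℂ) by push_cast; ring, Complex.re_ofReal_mul]

/-- The Gaussian weight under real-part coercivity: `a·S ≤ Re q ⟹ ‖e^{−q∕2}‖ ≤ e^{−(a∕2)S}`. [cite: Balaban1987RG1, (2.19) p.270 (positivity of the real part of the quadratic form; locator)] -/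
theorem norm_cexp_neg_half_mul_le {q : ℂ} {a S : ℝ} (h : a * S ≤ q.re) :
    ‖cexp (-(1 / 2 : ℂ) * q)‖ ≤ Real.exp (-(a / 2) * S) := by
  rw [Complex.norm_exp, re_neg_half_mul]
  exact Real.exp_le_exp.mpr (by linarith)

/-- The product Gaussian `x ↦ e^{−a·Σx_i²}` is integrable on `ι → ℝ` for `a > 0`. [cite: Balaban1987RG1, (2.12) p.268 (bookkeeping; Mathlib `GaussianFourier.integrable_cexp_neg_mul_sum_add`)] -/
theorem integrable_exp_neg_mul_sum_sq_pi {a : ℝ} (ha : 0 < a) :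
    Integrable (fun x : ι → ℝ => Real.exp (-a * ∑ i, x i ^ 2)) := by
  have h := (GaussianFourier.integrable_cexp_neg_mul_sum_add (ι := ι) (b := (a : ℂ)) (by simpa using ha) (fun _ => 0)).norm
  refine h.congr (Eventually.of_forall fun x => ?_)
  simp only [zero_mul, Finset.sum_const_zero, add_zero, Complex.norm_exp]
  congr 1
  have : (-(a : ℂ) * ∑ i, ((x i : ℝ) : ℂ) ^ 2) = ((-a * ∑ i, x i ^ 2 : ℝ) : ℂ) := by push_cast; ring
  rw [this, Complex.ofReal_re]

/-- ★★ **(H-den)** — `t ↦ gaussNormC (M t)` is holomorphic on an open `U` when the entries of `M` are holomorphic there and `Re quadC (M t)` is uniformly coercive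
(`a·Σx_i² ≤ Re quadC (M t) x`, `a > 0`).  No determinant, no branch of `det^{−1∕2}`. [cite: Balaban1987RG1, (2.12)+(2.19) p.268–270 (locator); Balaban1988RG2Cluster, (1.10)+(1.23) p.4–8 (analyticity in s; locator)] -/
theorem differentiableOn_gaussNormC {U : Set ℂ} (hU : IsOpen U) (M : ℂ → Matrix ι ι ℂ)
    (hM : ∀ i j, DifferentiableOn ℂ (fun t => M t i j) U) {a : ℝ} (ha : 0 < a)
    (hcoer : ∀ t ∈ U, ∀ x : ι → ℝ, a * ∑ i, x i ^ 2 ≤ (quadC (M t) x).re) :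
    DifferentiableOn ℂ (fun t => gaussNormC (M t)) U := by
  show DifferentiableOn ℂ (fun t => ∫ x : ι → ℝ, cexp (-(1 / 2 : ℂ) * quadC (M t) x)) U
  refine differentiableOn_integral_of_dominated_on hU
    (F := fun t (x : ι → ℝ) => cexp (-(1 / 2 : ℂ) * quadC (M t) x)) (bound := fun x => Real.exp (-(a / 2) * ∑ i, x i ^ 2)) ?_ ?_ ?_ ?_
  · intro t _
    exact (Complex.continuous_exp.comp (continuous_const.mul (continuous_quadC_real (M t)))).aestronglyMeasurable
  · exact Eventually.of_forall fun x => ((differentiableOn_const _).mul (differentiableOn_quadC_param M hM x)).cexp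
  · exact Eventually.of_forall fun x t ht => norm_cexp_neg_half_mul_le (hcoer t ht x)
  · exact integrable_exp_neg_mul_sum_sq_pi (half_pos ha)

/-- ★★ **(H-num)** — `t ↦ gaussIntC χ (M t) (E t)` is holomorphic on an open `U` for a measurable cut-off `|χ| ≤ 1`, a matrix family with holomorphic entries and uniformly coercive
real part, and an interaction `E t x` holomorphic in `t` (for `x ∈ supp χ`), measurable in `x`, with `Re E ≤ η` on `supp χ` uniformly in `t ∈ U` (dominator `e^{η}e^{−(a∕2)Σx_i²}`).
[cite: Balaban1987RG1, (2.12)–(2.13) p.268 (locator); Balaban1988RG2Cluster, (1.10)+(1.23) p.4–8 (locator)] -/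
theorem differentiableOn_gaussIntC {U : Set ℂ} (hU : IsOpen U) (χ : (ι → ℝ) → ℝ) (hχm : Measurable χ) (hχ : ∀ x, |χ x| ≤ 1)
    (M : ℂ → Matrix ι ι ℂ) (hM : ∀ i j, DifferentiableOn ℂ (fun t => M t i j) U) {a : ℝ} (ha : 0 < a)
    (hcoer : ∀ t ∈ U, ∀ x : ι → ℝ, a * ∑ i, x i ^ 2 ≤ (quadC (M t) x).re)
    (E : ℂ → (ι → ℝ) → ℂ) (hEm : ∀ t ∈ U, Measurable (E t)) (hEh : ∀ x, χ x ≠ 0 → DifferentiableOn ℂ (fun t => E t x) U)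
    (η : ℝ) (hEre : ∀ t ∈ U, ∀ x, χ x ≠ 0 → (E t x).re ≤ η) :
    DifferentiableOn ℂ (fun t => gaussIntC χ (M t) (E t)) U := by
  show DifferentiableOn ℂ (fun t => ∫ x : ι → ℝ, (χ x : ℂ) * cexp (-(1 / 2 : ℂ) * quadC (M t) x + E t x)) U
  refine differentiableOn_integral_of_dominated_on hU
    (F := fun t (x : ι → ℝ) => (χ x : ℂ) * cexp (-(1 / 2 : ℂ) * quadC (M t) x + E t x))
    (bound := fun x => Real.exp η * Real.exp (-(a / 2) * ∑ i, x i ^ 2)) ?_ ?_ ?_ ?_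
  · intro t ht
    exact ((Complex.measurable_ofReal.comp hχm).mul
      ((((continuous_const.mul (continuous_quadC_real (M t))).measurable).add (hEm t ht)).cexp)).aestronglyMeasurable
  · refine Eventually.of_forall fun x => ?_
    by_cases hx : χ x = 0
    · simp only [hx, Complex.ofReal_zero, zero_mul]; exact differentiableOn_const _
    · exact (differentiableOn_const _).mul ((((differentiableOn_const _).mul (differentiableOn_quadC_param M hM x)).add (hEh x hx)).cexp)
  · refine Eventually.of_forall fun x t ht => ?_
    by_cases hx : χ x = 0
    · simp only [hx, Complex.ofReal_zero, zero_mul, norm_zero]; positivity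
    · rw [norm_mul, Complex.norm_real, Real.norm_eq_abs, Complex.norm_exp, Complex.add_re, re_neg_half_mul, Real.exp_add]
      have h1 : Real.exp (-(1 / 2 : ℝ) * (quadC (M t) x).re) ≤ Real.exp (-(a / 2) * ∑ i, x i ^ 2) :=
        Real.exp_le_exp.mpr (by have := hcoer t ht x; linarith)
      have h2 : Real.exp (E t x).re ≤ Real.exp η := Real.exp_le_exp.mpr (hEre t ht x hx)
      calc |χ x| * (Real.exp (-(1 / 2 : ℝ) * (quadC (M t) x).re) * Real.exp (E t x).re)
          ≤ 1 * (Real.exp (-(a / 2) * ∑ i, x i ^ 2) * Real.exp η) :=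
            mul_le_mul (hχ x) (mul_le_mul h1 h2 (Real.exp_pos _).le (Real.exp_pos _).le) (by positivity) zero_le_one
        _ = Real.exp η * Real.exp (-(a / 2) * ∑ i, x i ^ 2) := by ring
  · exact (integrable_exp_neg_mul_sum_sq_pi (half_pos ha)).const_mul _

/-- ★★★ **(H-rat)** — the fluctuation RATIO `t ↦ gaussRatioC χ (M t) (E t)` is holomorphic on `U` under (H-num)'s hypotheses ALONE: the non-vanishing of the denominator is
`gaussNormC_ne_zero_of_coercive` (coercivity ⟹ `Re ½(M+Mᵀ) ≻ 0` ⟹ CGRS floor, via file №2's symmetrisation). [cite: Balaban1987RG1, (2.12)–(2.13)+(2.19) p.268–270 (locator); Balaban1988RG2Cluster, (1.10)+(1.23) p.4–8 (locator)] -/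
theorem differentiableOn_gaussRatioC [DecidableEq ι] {U : Set ℂ} (hU : IsOpen U) (χ : (ι → ℝ) → ℝ) (hχm : Measurable χ) (hχ : ∀ x, |χ x| ≤ 1)
    (M : ℂ → Matrix ι ι ℂ) (hM : ∀ i j, DifferentiableOn ℂ (fun t => M t i j) U) {a : ℝ} (ha : 0 < a)
    (hcoer : ∀ t ∈ U, ∀ x : ι → ℝ, a * ∑ i, x i ^ 2 ≤ (quadC (M t) x).re)
    (E : ℂ → (ι → ℝ) → ℂ) (hEm : ∀ t ∈ U, Measurable (E t)) (hEh : ∀ x, χ x ≠ 0 → DifferentiableOn ℂ (fun t => E t x) U)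
    (η : ℝ) (hEre : ∀ t ∈ U, ∀ x, χ x ≠ 0 → (E t x).re ≤ η) :
    DifferentiableOn ℂ (fun t => gaussRatioC χ (M t) (E t)) U :=
  (differentiableOn_gaussIntC hU χ hχm hχ M hM ha hcoer E hEm hEh η hEre).div (differentiableOn_gaussNormC hU M hM ha hcoer)
    fun t ht => gaussNormC_ne_zero_of_coercive (M t) ha (hcoer t ht)

/-- ★ THE DERIVATIVE OF THE NORMALISATION under the integral sign (H-den with the formula): `d∕dt gaussNormC (M t) = ∫ −½·quadC (M′ t₀) x · e^{−½ quadC (M t₀) x} dx` at `t₀ ∈ U`, where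
`M′ t₀ i j := deriv (M · i j) t₀`. [cite: Balaban1987RG1, (2.12) p.268 (locator); Balaban1988RG2Cluster, (1.23) p.8 (derivatives in s; locator)] -/
theorem hasDerivAt_gaussNormC {U : Set ℂ} (hU : IsOpen U) (M : ℂ → Matrix ι ι ℂ)
    (hM : ∀ i j, DifferentiableOn ℂ (fun t => M t i j) U) {a : ℝ} (ha : 0 < a)
    (hcoer : ∀ t ∈ U, ∀ x : ι → ℝ, a * ∑ i, x i ^ 2 ≤ (quadC (M t) x).re) {t₀ : ℂ} (ht₀ : t₀ ∈ U) :
    HasDerivAt (fun t => gaussNormC (M t))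
      (∫ x : ι → ℝ, (-(1 / 2 : ℂ) * quadC (fun i j => deriv (fun t => M t i j) t₀) x) * cexp (-(1 / 2 : ℂ) * quadC (M t₀) x)) t₀ := by
  have key := hasDerivAt_integral_of_dominated_on hU
    (F := fun t (x : ι → ℝ) => cexp (-(1 / 2 : ℂ) * quadC (M t) x)) (bound := fun x => Real.exp (-(a / 2) * ∑ i, x i ^ 2)) (μ := volume)
    (fun t _ => (Complex.continuous_exp.comp (continuous_const.mul (continuous_quadC_real (M t)))).aestronglyMeasurable)
    (Eventually.of_forall fun x => ((differentiableOn_const _).mul (differentiableOn_quadC_param M hM x)).cexp)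
    (Eventually.of_forall fun x t ht => norm_cexp_neg_half_mul_le (hcoer t ht x))
    (integrable_exp_neg_mul_sum_sq_pi (half_pos ha)) ht₀
  have hderiv : ∀ x : ι → ℝ, deriv (fun t => cexp (-(1 / 2 : ℂ) * quadC (M t) x)) t₀
      = (-(1 / 2 : ℂ) * quadC (fun i j => deriv (fun t => M t i j) t₀) x) * cexp (-(1 / 2 : ℂ) * quadC (M t₀) x) := by
    intro x
    have hMd : ∀ i j, HasDerivAt (fun t => M t i j) (deriv (fun t => M t i j) t₀) t₀ := fun i j =>
      ((hM i j).differentiableAt (hU.mem_nhds ht₀)).hasDerivAt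
    have hq : HasDerivAt (fun t => quadC (M t) x) (quadC (fun i j => deriv (fun t => M t i j) t₀) x) t₀ := by
      unfold quadC
      have : (fun t => ∑ i, ∑ j, (x i : ℂ) * M t i j * (x j : ℂ)) = fun t => ∑ i, ∑ j, (fun t => (x i : ℂ) * M t i j * (x j : ℂ)) t := rfl
      rw [this]
      refine HasDerivAt.fun_sum fun i _ => HasDerivAt.fun_sum fun j _ => ?_
      simpa using ((hMd i j).const_mul (x i : ℂ)).mul_const (x j : ℂ)
    have h := (hq.const_mul (-(1 / 2 : ℂ))).cexp
    rw [h.deriv]; ring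
  simp_rw [hderiv] at key
  exact key.2

/-! ## §13  DOCKING onto the Cauchy–decoupling brick (✓`…K0AxCauchyDecoupling` :124 `SepHolOff`, :128 `BddOnPoly`, :207 `norm_decDiffList_le_exp_of_le_length`):
SEPARATE hypotheses along the coordinate lines `t ↦ update s y t` (`s ∈ cpoly R`, `‖t‖ < R'`, `R < R'`; the parameter index `κ` may be INFINITE — print's `s : (Fin 4 → ℤ) → ℂ`) and
pointwise hypotheses on the closed polydisc `cpoly R'` give `SepHolOff R []`; pointwise hypotheses on `cpoly R` give `BddOnPoly R (e^{η + τ∕4})` — for `G := s ↦ gaussRatioC χ (M s) (E s)`. -/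

/-- The closed polydiscs are monotone in the radius (bookkeeping; with ✓`update_mem_cpoly` :99 it freezes all parameters but one). [cite: Balaban1988RG2Cluster, (1.10) p.4–5 (locator; bookkeeping)] -/
theorem cpoly_mono {κ : Type*} [DecidableEq κ] {R R' : ℝ} (hRR' : R ≤ R') : cpoly (ι := κ) R ⊆ cpoly (ι := κ) R' := fun _ hs i => (hs i).trans hRR'

/-- ★★ **DOCKING (holomorphy):** along every coordinate line through `cpoly R` the matrix entries and (on `supp χ`) the interaction are holomorphic on `ball 0 R'` (`R < R'`); on `cpoly R'`:
measurability of `E s`, uniform real-part coercivity `a > 0` and `Re E ≤ η` on `supp χ`; `χ` measurable with `|χ| ≤ 1` ⟹ `SepHolOff R [] (s ↦ gaussRatioC χ (M s) (E s))` — the holomorphy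
input of ✓`norm_decDiffList_le_exp_of_le_length`.  No norm on `κ → ℂ` is used (`κ` arbitrary). [cite: Balaban1988RG2Cluster, (1.10)+(1.23) p.4–8 (locator); Brydges1986, Part III §2 (locator)] -/
theorem sepHolOff_gaussRatioC [DecidableEq ι] {κ : Type*} [DecidableEq κ] {R R' : ℝ} (hRR' : R < R')
    (χ : (ι → ℝ) → ℝ) (hχm : Measurable χ) (hχ : ∀ x, |χ x| ≤ 1) (M : (κ → ℂ) → Matrix ι ι ℂ)
    (hM : ∀ s ∈ cpoly (ι := κ) R, ∀ y i j, DifferentiableOn ℂ (fun t : ℂ => M (update s y t) i j) (ball (0 : ℂ) R')) {a : ℝ} (ha : 0 < a)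
    (hcoer : ∀ s ∈ cpoly (ι := κ) R', ∀ x : ι → ℝ, a * ∑ i, x i ^ 2 ≤ (quadC (M s) x).re)
    (E : (κ → ℂ) → (ι → ℝ) → ℂ) (hEm : ∀ s ∈ cpoly (ι := κ) R', Measurable (E s))
    (hEh : ∀ s ∈ cpoly (ι := κ) R, ∀ y x, χ x ≠ 0 → DifferentiableOn ℂ (fun t : ℂ => E (update s y t) x) (ball (0 : ℂ) R'))
    (η : ℝ) (hEre : ∀ s ∈ cpoly (ι := κ) R', ∀ x, χ x ≠ 0 → (E s x).re ≤ η) :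
    SepHolOff R [] (fun s => gaussRatioC χ (M s) (E s)) :=
  sepHolOff_of_differentiableOn hRR' _ fun s hs y =>
    have hin : ∀ t ∈ ball (0 : ℂ) R', update s y t ∈ cpoly (ι := κ) R' := fun _ ht =>
      update_mem_cpoly (cpoly_mono hRR'.le hs) y (le_of_lt (mem_ball_zero_iff.mp ht))
    differentiableOn_gaussRatioC isOpen_ball χ hχm hχ (fun t => M (update s y t)) (hM s hs y) ha (fun t ht => hcoer _ (hin t ht))
      (fun t => E (update s y t)) (fun t ht => hEm _ (hin t ht)) (fun x hx => hEh s hs y x hx) η (fun t ht => hEre _ (hin t ht))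

/-- ★★ **DOCKING (bound):** uniform real-part coercivity, `0 ≤ χ ≤ 1`, `Re E ≤ η` on `supp χ` and an imaginary-part trace budget `tr(S⁻¹B S⁻¹B) ≤ τ` (`S,B` = real∕imaginary parts of
`½(M+Mᵀ)`) on the closed polydisc ⟹ `BddOnPoly R (e^{η + τ∕4}) (s ↦ gaussRatioC χ (M s) (E s))` — the bound input of ✓`norm_decDiffList_le_exp_of_le_length` (CGRS (iii) in the coercive form
`norm_gaussRatioC_le_exp_trace_of_coercive`). [cite: Balaban1988RG2Cluster, (1.18) p.7 (the shape `M·e^{−κ n}`; locator); Brydges1986, Part III §2 (locator)] -/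
theorem bddOnPoly_gaussRatioC [DecidableEq ι] {κ : Type*} [DecidableEq κ] {R : ℝ} (χ : (ι → ℝ) → ℝ) (hχ : ∀ x, 0 ≤ χ x ∧ χ x ≤ 1)
    (M : (κ → ℂ) → Matrix ι ι ℂ) (E : (κ → ℂ) → (ι → ℝ) → ℂ) {a : ℝ} (ha : 0 < a) (η τ : ℝ)
    (hcoer : ∀ s ∈ cpoly (ι := κ) R, ∀ x : ι → ℝ, a * ∑ i, x i ^ 2 ≤ (quadC (M s) x).re)
    (hEre : ∀ s ∈ cpoly (ι := κ) R, ∀ x, χ x ≠ 0 → (E s x).re ≤ η)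
    (htr : ∀ s ∈ cpoly (ι := κ) R,
      (((gaussSymmPart (M s)).map Complex.re)⁻¹ * (gaussSymmPart (M s)).map Complex.im
          * ((gaussSymmPart (M s)).map Complex.re)⁻¹ * (gaussSymmPart (M s)).map Complex.im).trace ≤ τ) :
    BddOnPoly R (Real.exp (η + (1 / 4 : ℝ) * τ)) (fun s => gaussRatioC χ (M s) (E s)) := fun s hs =>
  (norm_gaussRatioC_le_exp_trace_of_coercive χ (M s) (E s) η ha (hcoer s hs) hχ (hEre s hs)).trans
    (Real.exp_le_exp.mpr (by have := htr s hs; linarith))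


end GaussHolo

end Summit.QuantumFields.YangMills.Theorems.K0AxComplexGaussianRatio

end
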